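import Literature.Analysis.FluidPDE.FractionalNSTorus
import Literature.Analysis.FunctionSpaces.TorusFourierSeries
import HarnessLib

/-!
# The spectral fractional Laplacian on smooth fields of the flat torus: convergence, symmetry, eigenmodes

Analysis/FluidPDE support file (proof-only complement to `FractionalNSTorus`, whose
`Torus.fracLaplacian α ψ x = Re ∑ₖ (4π²|k|²)^α ψ̂(k) e^{2πik·x}` is defined by a `tsum` and comes
with no convergence statement). For exponents `α ≥ 0` and smooth real vector fields on
`T^d = UnitAddTorus d` we prove what is needed to treat `(-Δ)^α` as an honest operator in weak
formulations (Colombo–De Lellis–De Rosa 2018, §1; Luo–Titi 2020, §1 (1.1): the hyper- or hypo-viscous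
term `ν(-Δ)^θ v`, moved onto the test field in the distributional formulation):

* `Torus.summable_fracSymbol_mul_norm` — `∑ₖ (4π²|k|²)^α ‖â(k)‖ < ∞` for smooth `a` (polynomial
  decay of the coefficients of smooth fields, `TorusFourierSeries`), with the explicit majorant
  `(4π²)^α K ((1+|k|²)^{#d})⁻¹` (`Torus.fracSymbol_mul_norm_le`);
* `Torus.hasSum_fracLaplacian` — the defining series converges (absolutely) to
  `fracLaplacian α a x`; sup bound `Torus.norm_fracLaplacian_le`; continuity
  `Torus.continuous_fracLaplacian`;
* `Torus.integral_inner_fracLaplacian_eq_tsum` — Parseval form of the pairing,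
  `∫ ⟪b, (-Δ)^α a⟫ = ∑ₖ (4π²|k|²)^α Re ⟪b̂(k), â(k)⟫`, and the **symmetry**
  `∫ ⟪(-Δ)^α a, b⟫ = ∫ ⟪a, (-Δ)^α b⟫` for smooth `a`, `b` (`Torus.integral_inner_fracLaplacian_comm`);
* `Torus.fracLaplacian_realTrigPoly` — characters are eigenfunctions: on a real trigonometric
  polynomial `(-Δ)^α` multiplies the `k`-th coefficient by `(4π²|k|²)^α`;
* space–time fields smooth on `ℝ × T^d`: uniform majorants on compact time sets
  (`Torus.exists_fracSymbol_mul_norm_le_spaceTime`, `Torus.exists_norm_fracLaplacian_le`) and joint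
  continuity of `(t, x) ↦ ((-Δ)^α ψ(t))(x)` (`Torus.continuous_stLift_fracLaplacian`).

All statements are folklore Fourier analysis on the torus (Grafakos 2014, Prop. 3.2.6–3.2.7,
§3.3.1); Mathlib has no fractional Laplacian on `UnitAddTorus` (see `FractionalNSTorus`).

## References

* L. Grafakos, *Classical Fourier Analysis*, 3rd ed., GTM 249, Springer 2014, Prop. 3.2.6,
  Prop. 3.2.7, §3.3.1. [`Grafakos2014`]
* M. Colombo, C. De Lellis, L. De Rosa, Comm. Math. Phys. 362 (2018), §1. [`ColomboDelellisDerosa2018`]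
* T. Luo, E. S. Titi, Calc. Var. PDE 59 (2020), §1 (1.1). [`LuoTiti2020`]
-/

noncomputable section

open MeasureTheory Set Filter Topology UnitAddTorus
open scoped ENNReal NNReal InnerProductSpace ContDiff

namespace Literature.Analysis.FluidPDE

namespace Torus

variable {d : Type*} [Fintype d]

/-! ## The symbol against polynomial weights -/

section Symbol

/-- For `α ≥ 0`, `(4π²|k|²)^α ≤ (4π²)^α (1 + |k|²)^⌈α⌉`. [folklore] -/
theorem fracSymbol_le_mul_pow {θ : ℝ} (hθ : 0 ≤ θ) (k : d → ℤ) :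
    fracSymbol θ k ≤ (4 * Real.pi ^ 2) ^ θ * (1 + FunctionSpaces.Torus.freqNormSq k) ^ ⌈θ⌉₊ := by
  have h4 : (0 : ℝ) ≤ 4 * Real.pi ^ 2 := by positivity
  have hk := FunctionSpaces.Torus.freqNormSq_nonneg k
  unfold fracSymbol
  rw [Real.mul_rpow h4 hk]
  refine mul_le_mul_of_nonneg_left ?_ (Real.rpow_nonneg h4 θ)
  calc FunctionSpaces.Torus.freqNormSq k ^ θ ≤ (1 + FunctionSpaces.Torus.freqNormSq k) ^ θ := Real.rpow_le_rpow hk (by linarith) hθ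
    _ ≤ (1 + FunctionSpaces.Torus.freqNormSq k) ^ ((⌈θ⌉₊ : ℕ) : ℝ) :=
        Real.rpow_le_rpow_of_exponent_le (by linarith) (Nat.le_ceil θ)
    _ = (1 + FunctionSpaces.Torus.freqNormSq k) ^ ⌈θ⌉₊ := Real.rpow_natCast _ _

/-- `‖(4π²|k|²)^α • (e_k(x) • c)‖ ≤ (4π²|k|²)^α ‖c‖` (`|e_k(x)| = 1`). [folklore] -/
theorem norm_fracSymbol_smul_mFourier_smul_le (θ : ℝ) (k : d → ℤ) (x : UnitAddTorus d)
    (c : EuclideanSpace ℂ d) :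
    ‖fracSymbol θ k • (mFourier k x • c)‖ ≤ fracSymbol θ k * ‖c‖ := by
  rw [norm_smul, Real.norm_of_nonneg (fracSymbol_nonneg θ k), norm_smul]
  refine mul_le_mul_of_nonneg_left ?_ (fracSymbol_nonneg θ k)
  calc ‖mFourier k x‖ * ‖c‖ ≤ 1 * ‖c‖ :=
        mul_le_mul_of_nonneg_right (((mFourier k).norm_coe_le_norm x).trans_eq mFourier_norm)
          (norm_nonneg _)
    _ = ‖c‖ := one_mul _

/-- Real scalars pass through the character: `σ • (e_k(x) • c) = e_k(x) • ((σ : ℂ) • c)`. [folklore] -/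
theorem fracSymbol_smul_mFourier_smul (θ : ℝ) (k : d → ℤ) (x : UnitAddTorus d)
    (c : EuclideanSpace ℂ d) :
    fracSymbol θ k • (mFourier k x • c) = mFourier k x • (((fracSymbol θ k : ℝ) : ℂ) • c) := by
  rw [← Complex.coe_smul, smul_comm]

end Symbol

/-! ## Absolute convergence of the defining series for smooth fields -/

section Smooth

variable [DecidableEq d]

/-- **Weighted decay.** If `‖((1 - (4π²)⁻¹Δ)^{⌈α⌉ + #d} a)(x)‖ ≤ K` on the torus, then
`(4π²|k|²)^α ‖â(k)‖ ≤ (4π²)^α K ((1 + |k|²)^{#d})⁻¹` for every frequency `k` (`α ≥ 0`;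
Grafakos 2014, Prop. 3.2.6 (8) / §3.3.1, via `Torus.norm_mFourierCoeff_le_of_iterate_bound`). [folklore] -/
theorem fracSymbol_mul_norm_le {θ : ℝ} (hθ : 0 ≤ θ) {a : UnitAddTorus d → EuclideanSpace ℝ d}
    (ha : FunctionSpaces.Torus.IsSmooth a) {K : ℝ}
    (hK : ∀ x, ‖((fun b : UnitAddTorus d → EuclideanSpace ℝ d =>
      fun x => b x - (4 * Real.pi ^ 2)⁻¹ • FunctionSpaces.Torus.laplacian b x)^[⌈θ⌉₊ + Fintype.card d] a) x‖ ≤ K)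
    (k : d → ℤ) :
    fracSymbol θ k * ‖mFourierCoeff (FunctionSpaces.EuclideanSpace.complexify ∘ a) k‖ ≤
      (4 * Real.pi ^ 2) ^ θ * K * ((1 + FunctionSpaces.Torus.freqNormSq k) ^ Fintype.card d)⁻¹ := by
  have h1 := FunctionSpaces.Torus.norm_mFourierCoeff_le_of_iterate_bound ha hK k
  have hq : 0 < 1 + FunctionSpaces.Torus.freqNormSq k := by linarith [FunctionSpaces.Torus.freqNormSq_nonneg k]
  have hK0 : 0 ≤ K := (norm_nonneg _).trans (hK 0)
  have h4 : 0 ≤ (4 * Real.pi ^ 2) ^ θ := Real.rpow_nonneg (by positivity) θ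
  calc fracSymbol θ k * ‖mFourierCoeff (FunctionSpaces.EuclideanSpace.complexify ∘ a) k‖
      ≤ ((4 * Real.pi ^ 2) ^ θ * (1 + FunctionSpaces.Torus.freqNormSq k) ^ ⌈θ⌉₊) *
          (K * ((1 + FunctionSpaces.Torus.freqNormSq k) ^ (⌈θ⌉₊ + Fintype.card d))⁻¹) :=
        mul_le_mul (fracSymbol_le_mul_pow hθ k) h1 (norm_nonneg _) (by positivity)
    _ = (4 * Real.pi ^ 2) ^ θ * K * ((1 + FunctionSpaces.Torus.freqNormSq k) ^ Fintype.card d)⁻¹ := by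
        rw [pow_add]
        field_simp

/-- **`∑ₖ (4π²|k|²)^α ‖â(k)‖ < ∞` for smooth `a : T^d → ℝ^d` and `α ≥ 0`** (Grafakos 2014,
§3.3.1: coefficients of smooth functions decay faster than any polynomial). [folklore] -/
theorem summable_fracSymbol_mul_norm {θ : ℝ} (hθ : 0 ≤ θ)
    {a : UnitAddTorus d → EuclideanSpace ℝ d} (ha : FunctionSpaces.Torus.IsSmooth a) :
    Summable fun k : d → ℤ => fracSymbol θ k * ‖mFourierCoeff (FunctionSpaces.EuclideanSpace.complexify ∘ a) k‖ := by
  obtain ⟨K, -, hK⟩ := FunctionSpaces.Torus.exists_iterate_bound ha (⌈θ⌉₊ + Fintype.card d)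
  exact Summable.of_nonneg_of_le (fun k => mul_nonneg (fracSymbol_nonneg θ k) (norm_nonneg _))
    (fracSymbol_mul_norm_le hθ ha hK) (FunctionSpaces.Torus.summable_inv_one_add_freqNormSq_pow_card.mul_left _)

/-- The `ℂ^d`-valued modes `(4π²|k|²)^α ê_k(x) â(k)` of `(-Δ)^α a` are absolutely summable. [folklore] -/
theorem summable_fracSymbol_smul_mFourier_smul {θ : ℝ} (hθ : 0 ≤ θ)
    {a : UnitAddTorus d → EuclideanSpace ℝ d} (ha : FunctionSpaces.Torus.IsSmooth a) (x : UnitAddTorus d) :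
    Summable fun k : d → ℤ =>
      fracSymbol θ k • (mFourier k x • mFourierCoeff (FunctionSpaces.EuclideanSpace.complexify ∘ a) k) :=
  Summable.of_norm_bounded (summable_fracSymbol_mul_norm hθ ha)
    fun k => norm_fracSymbol_smul_mFourier_smul_le θ k x _

/-- **The defining series of `(-Δ)^α a` converges**: for smooth `a` and `α ≥ 0`,
`((-Δ)^α a)(x) = ∑ₖ Re ((4π²|k|²)^α e_k(x) â(k))` as an (unconditionally) convergent sum. [folklore] -/
theorem hasSum_fracLaplacian {θ : ℝ} (hθ : 0 ≤ θ) {a : UnitAddTorus d → EuclideanSpace ℝ d}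
    (ha : FunctionSpaces.Torus.IsSmooth a) (x : UnitAddTorus d) :
    HasSum (fun k : d → ℤ => FunctionSpaces.EuclideanSpace.realPart
      (fracSymbol θ k • (mFourier k x • mFourierCoeff (FunctionSpaces.EuclideanSpace.complexify ∘ a) k)))
      (fracLaplacian θ a x) := by
  rw [fracLaplacian_def]
  exact (summable_fracSymbol_smul_mFourier_smul hθ ha x).hasSum.mapL FunctionSpaces.EuclideanSpace.realPart

/-- `(-Δ)^α a (x)` as the `tsum` of its real modes. [folklore] -/
theorem fracLaplacian_eq_tsum_realPart {θ : ℝ} (hθ : 0 ≤ θ)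
    {a : UnitAddTorus d → EuclideanSpace ℝ d} (ha : FunctionSpaces.Torus.IsSmooth a) (x : UnitAddTorus d) :
    fracLaplacian θ a x = ∑' k : d → ℤ, FunctionSpaces.EuclideanSpace.realPart
      (fracSymbol θ k • (mFourier k x • mFourierCoeff (FunctionSpaces.EuclideanSpace.complexify ∘ a) k)) :=
  (hasSum_fracLaplacian hθ ha x).tsum_eq.symm

omit [DecidableEq d] in
/-- Each real mode is bounded by the corresponding weighted coefficient. [folklore] -/
theorem norm_realPart_fracSymbol_smul_le (θ : ℝ) (k : d → ℤ) (x : UnitAddTorus d)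
    (c : EuclideanSpace ℂ d) :
    ‖FunctionSpaces.EuclideanSpace.realPart (fracSymbol θ k • (mFourier k x • c))‖ ≤ fracSymbol θ k * ‖c‖ :=
  (FunctionSpaces.EuclideanSpace.norm_realPart_le _).trans (norm_fracSymbol_smul_mFourier_smul_le θ k x c)

/-- **Sup bound**: `‖((-Δ)^α a)(x)‖ ≤ ∑ₖ (4π²|k|²)^α ‖â(k)‖`. [folklore] -/
theorem norm_fracLaplacian_le {θ : ℝ} (hθ : 0 ≤ θ) {a : UnitAddTorus d → EuclideanSpace ℝ d}
    (ha : FunctionSpaces.Torus.IsSmooth a) (x : UnitAddTorus d) :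
    ‖fracLaplacian θ a x‖ ≤
      ∑' k : d → ℤ, fracSymbol θ k * ‖mFourierCoeff (FunctionSpaces.EuclideanSpace.complexify ∘ a) k‖ := by
  rw [fracLaplacian_eq_tsum_realPart hθ ha x]
  have hs := summable_fracSymbol_mul_norm hθ ha
  have hs' : Summable fun k : d → ℤ => ‖FunctionSpaces.EuclideanSpace.realPart
      (fracSymbol θ k • (mFourier k x • mFourierCoeff (FunctionSpaces.EuclideanSpace.complexify ∘ a) k))‖ :=
    Summable.of_nonneg_of_le (fun k => norm_nonneg _)
      (fun k => norm_realPart_fracSymbol_smul_le θ k x _) hs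
  exact (norm_tsum_le_tsum_norm hs').trans
    (Summable.tsum_le_tsum (fun k => norm_realPart_fracSymbol_smul_le θ k x _) hs' hs)

/-- The sup bound in terms of a decay constant:
`‖((-Δ)^α a)(x)‖ ≤ (4π²)^α K ∑ₖ ((1 + |k|²)^{#d})⁻¹`. [folklore] -/
theorem norm_fracLaplacian_le_of_iterate_bound {θ : ℝ} (hθ : 0 ≤ θ)
    {a : UnitAddTorus d → EuclideanSpace ℝ d} (ha : FunctionSpaces.Torus.IsSmooth a) {K : ℝ}
    (hK : ∀ x, ‖((fun b : UnitAddTorus d → EuclideanSpace ℝ d =>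
      fun x => b x - (4 * Real.pi ^ 2)⁻¹ • FunctionSpaces.Torus.laplacian b x)^[⌈θ⌉₊ + Fintype.card d] a) x‖ ≤ K)
    (x : UnitAddTorus d) :
    ‖fracLaplacian θ a x‖ ≤ (4 * Real.pi ^ 2) ^ θ * K *
      ∑' k : d → ℤ, ((1 + FunctionSpaces.Torus.freqNormSq k) ^ Fintype.card d)⁻¹ := by
  refine (norm_fracLaplacian_le hθ ha x).trans ?_
  rw [← tsum_mul_left]
  exact Summable.tsum_le_tsum (fracSymbol_mul_norm_le hθ ha hK) (summable_fracSymbol_mul_norm hθ ha)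
    (FunctionSpaces.Torus.summable_inv_one_add_freqNormSq_pow_card.mul_left _)

/-- **`(-Δ)^α a` is continuous** for smooth `a` (uniform limit of trigonometric polynomials). [folklore] -/
theorem continuous_fracLaplacian {θ : ℝ} (hθ : 0 ≤ θ) {a : UnitAddTorus d → EuclideanSpace ℝ d}
    (ha : FunctionSpaces.Torus.IsSmooth a) : Continuous (fracLaplacian θ a) := by
  have hfun : fracLaplacian θ a = fun x => ∑' k : d → ℤ, FunctionSpaces.EuclideanSpace.realPart
      (fracSymbol θ k • (mFourier k x • mFourierCoeff (FunctionSpaces.EuclideanSpace.complexify ∘ a) k)) :=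
    funext fun x => fracLaplacian_eq_tsum_realPart hθ ha x
  rw [hfun]
  refine continuous_tsum (fun k => ?_) (summable_fracSymbol_mul_norm hθ ha)
    (fun k x => norm_realPart_fracSymbol_smul_le θ k x _)
  exact FunctionSpaces.EuclideanSpace.realPart.continuous.comp
    ((continuous_const (y := fracSymbol θ k)).smul
      ((mFourier k).continuous.smul continuous_const))

/-- `(-Δ)^α a` is integrable on the torus for smooth `a`. [folklore] -/
theorem integrable_fracLaplacian {θ : ℝ} (hθ : 0 ≤ θ) {a : UnitAddTorus d → EuclideanSpace ℝ d}
    (ha : FunctionSpaces.Torus.IsSmooth a) : Integrable (fracLaplacian θ a) volume :=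
  (continuous_fracLaplacian hθ ha).integrable_unitAddTorus

/-! ## Parseval form of the pairing and symmetry -/

/-- **The pairing in Fourier variables**: for smooth `a`, continuous `b` and `α ≥ 0`,
`∫ ⟪b, (-Δ)^α a⟫ = ∑ₖ (4π²|k|²)^α Re ⟪b̂(k), â(k)⟫_ℂ` (termwise integration of the absolutely
convergent series, orthogonality `∫ ⟪b, Re(e_k z)⟫ = Re ⟪b̂(k), z⟫`;
Grafakos 2014, Prop. 3.2.7). [folklore] -/
theorem integral_inner_fracLaplacian_eq_tsum {θ : ℝ} (hθ : 0 ≤ θ)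
    {a b : UnitAddTorus d → EuclideanSpace ℝ d} (ha : FunctionSpaces.Torus.IsSmooth a) (hb : Continuous b) :
    ∫ x, ⟪b x, fracLaplacian θ a x⟫_ℝ = ∑' k : d → ℤ, fracSymbol θ k *
      (⟪mFourierCoeff (FunctionSpaces.EuclideanSpace.complexify ∘ b) k,
        mFourierCoeff (FunctionSpaces.EuclideanSpace.complexify ∘ a) k⟫_ℂ).re := by
  set F : (d → ℤ) → UnitAddTorus d → ℝ := fun k x => ⟪b x, FunctionSpaces.EuclideanSpace.realPart
    (fracSymbol θ k • (mFourier k x • mFourierCoeff (FunctionSpaces.EuclideanSpace.complexify ∘ a) k))⟫_ℝ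
    with hF
  have hpt : ∀ x, HasSum (fun k => F k x) ⟪b x, fracLaplacian θ a x⟫_ℝ := fun x =>
    (hasSum_fracLaplacian hθ ha x).mapL (innerSL ℝ (b x))
  have hfun : (fun x => ⟪b x, fracLaplacian θ a x⟫_ℝ) = fun x => ∑' k, F k x :=
    funext fun x => (hpt x).tsum_eq.symm
  rw [hfun]
  -- sup bound for `b`
  obtain ⟨B, hB⟩ := (isCompact_univ.image hb).isBounded.exists_norm_le
  have hB' : ∀ x, ‖b x‖ ≤ B := fun x => hB _ ⟨x, mem_univ _, rfl⟩
  have hB0 : 0 ≤ B := (norm_nonneg _).trans (hB' 0)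
  have hFle : ∀ k x, ‖F k x‖ ≤
      B * (fracSymbol θ k * ‖mFourierCoeff (FunctionSpaces.EuclideanSpace.complexify ∘ a) k‖) := by
    intro k x
    calc ‖F k x‖ ≤ ‖b x‖ * ‖FunctionSpaces.EuclideanSpace.realPart (fracSymbol θ k •
          (mFourier k x • mFourierCoeff (FunctionSpaces.EuclideanSpace.complexify ∘ a) k))‖ :=
          norm_inner_le_norm _ _
      _ ≤ B * (fracSymbol θ k * ‖mFourierCoeff (FunctionSpaces.EuclideanSpace.complexify ∘ a) k‖) :=
          mul_le_mul (hB' x) (norm_realPart_fracSymbol_smul_le θ k x _) (norm_nonneg _) hB0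
  have hFcont : ∀ k, Continuous (F k) := fun k =>
    hb.inner (FunctionSpaces.EuclideanSpace.realPart.continuous.comp
      ((continuous_const (y := fracSymbol θ k)).smul
        ((mFourier k).continuous.smul continuous_const)))
  rw [integral_tsum (fun k => (hFcont k).aestronglyMeasurable)]
  · refine tsum_congr fun k => ?_
    simp only [hF, fracSymbol_smul_mFourier_smul]
    rw [FunctionSpaces.Torus.integral_inner_realPart_mFourier_smul hb.integrable_unitAddTorus k, inner_smul_right,
      Complex.re_ofReal_mul]
  · -- `∑ₖ ∫ ‖F k‖ ≤ ∑ₖ B σ_k ‖â k‖ < ∞`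
    have hle : ∀ k, ∫⁻ x, ‖F k x‖ₑ ≤ ENNReal.ofReal
        (B * (fracSymbol θ k * ‖mFourierCoeff (FunctionSpaces.EuclideanSpace.complexify ∘ a) k‖)) := by
      intro k
      calc ∫⁻ x, ‖F k x‖ₑ ≤ ∫⁻ _ : UnitAddTorus d, ENNReal.ofReal
            (B * (fracSymbol θ k * ‖mFourierCoeff (FunctionSpaces.EuclideanSpace.complexify ∘ a) k‖)) := by
            refine lintegral_mono fun x => ?_
            rw [← ofReal_norm]
            exact ENNReal.ofReal_le_ofReal (hFle k x)
        _ = _ := by rw [lintegral_const, measure_univ, mul_one]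
    refine ne_top_of_le_ne_top ?_ (ENNReal.tsum_le_tsum hle)
    rw [← ENNReal.ofReal_tsum_of_nonneg (fun k => mul_nonneg hB0
      (mul_nonneg (fracSymbol_nonneg θ k) (norm_nonneg _)))
      ((summable_fracSymbol_mul_norm hθ ha).mul_left B)]
    exact ENNReal.ofReal_ne_top

/-- **Symmetry of `(-Δ)^α` on smooth fields**: `∫ ⟪(-Δ)^α a, b⟫ = ∫ ⟪a, (-Δ)^α b⟫`
(both sides equal `∑ₖ (4π²|k|²)^α Re ⟪â(k), b̂(k)⟫`; the symbol is real and
`Re ⟪z, w⟫ = Re ⟪w, z⟫`). This is the identity by which the hyperviscous term is moved onto the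
test field in the distributional formulation (Luo–Titi 2020, Def. 1.1). [folklore] -/
theorem integral_inner_fracLaplacian_comm {θ : ℝ} (hθ : 0 ≤ θ)
    {a b : UnitAddTorus d → EuclideanSpace ℝ d} (ha : FunctionSpaces.Torus.IsSmooth a) (hb : FunctionSpaces.Torus.IsSmooth b) :
    ∫ x, ⟪fracLaplacian θ a x, b x⟫_ℝ = ∫ x, ⟪a x, fracLaplacian θ b x⟫_ℝ := by
  have h1 : (fun x => ⟪fracLaplacian θ a x, b x⟫_ℝ) = fun x => ⟪b x, fracLaplacian θ a x⟫_ℝ :=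
    funext fun x => real_inner_comm _ _
  rw [h1, integral_inner_fracLaplacian_eq_tsum hθ ha hb.continuous,
    integral_inner_fracLaplacian_eq_tsum hθ hb ha.continuous]
  refine tsum_congr fun k => ?_
  congr 1
  have h := inner_re_symm (𝕜 := ℂ) (mFourierCoeff (FunctionSpaces.EuclideanSpace.complexify ∘ b) k)
    (mFourierCoeff (FunctionSpaces.EuclideanSpace.complexify ∘ a) k)
  simpa using h

/-! ## Eigenmodes: `(-Δ)^α` on real trigonometric polynomials -/

omit [DecidableEq d] in
/-- **Characters are eigenfunctions of `(-Δ)^α`**: for a symmetric frequency set `S` and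
conjugate-symmetric coefficients `c` (so that `realTrigPoly S c` has coefficients `c` on `S` and
`0` off `S`), `(-Δ)^α (realTrigPoly S c) = realTrigPoly S (k ↦ (4π²|k|²)^α c k)` — any real `α`
(Grafakos 2014, Prop. 3.2.6 (8) for Fourier multipliers). [folklore] -/
theorem fracLaplacian_realTrigPoly {S : Finset (d → ℤ)} (hS : ∀ k ∈ S, -k ∈ S)
    {c : (d → ℤ) → EuclideanSpace ℂ d} (hc : FunctionSpaces.Torus.IsConjSymm c) (θ : ℝ) (x : UnitAddTorus d) :
    fracLaplacian θ (FunctionSpaces.Torus.realTrigPoly S c) x =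
      FunctionSpaces.Torus.realTrigPoly S (fun k => ((fracSymbol θ k : ℝ) : ℂ) • c k) x := by
  classical
  rw [fracLaplacian_def, FunctionSpaces.Torus.realTrigPoly_apply_eq_sum]
  have hcoef : ∀ k, mFourierCoeff (FunctionSpaces.EuclideanSpace.complexify ∘ FunctionSpaces.Torus.realTrigPoly S c) k =
      if k ∈ S then c k else 0 := FunctionSpaces.Torus.mFourierCoeff_realTrigPoly hS hc
  simp_rw [hcoef]
  rw [tsum_eq_sum (s := S) (fun k hk => by rw [if_neg hk, smul_zero, smul_zero]), map_sum]
  refine Finset.sum_congr rfl fun k hk => ?_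
  rw [if_pos hk, fracSymbol_smul_mFourier_smul]

end Smooth

/-! ## Space–time fields smooth on `ℝ × T^d` -/

section SpaceTime

variable [DecidableEq d]

/-- **Uniform weighted decay on compact time sets**: for `ψ` smooth on `ℝ × T^d`, `α ≥ 0` and a
compact `K ⊆ ℝ`, there is `M ≥ 0` with `(4π²|k|²)^α ‖𝓕(ψ t)(k)‖ ≤ M ((1 + |k|²)^{#d})⁻¹` for all
`t ∈ K` and all `k`. [folklore] -/
theorem exists_fracSymbol_mul_norm_le_spaceTime {θ : ℝ} (hθ : 0 ≤ θ)
    {ψ : ℝ → UnitAddTorus d → EuclideanSpace ℝ d} (hψ : FunctionSpaces.Torus.IsSmoothSpaceTimeOn univ ψ)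
    {K : Set ℝ} (hK : IsCompact K) :
    ∃ M : ℝ, 0 ≤ M ∧ ∀ t ∈ K, ∀ k : d → ℤ,
      fracSymbol θ k * ‖mFourierCoeff (FunctionSpaces.EuclideanSpace.complexify ∘ ψ t) k‖ ≤
        M * ((1 + FunctionSpaces.Torus.freqNormSq k) ^ Fintype.card d)⁻¹ := by
  obtain ⟨C, hC⟩ := (FunctionSpaces.Torus.isSmoothSpaceTimeOn_iterate hψ (⌈θ⌉₊ + Fintype.card d)).exists_norm_le_of_isCompact
    hK (subset_univ _)
  refine ⟨(4 * Real.pi ^ 2) ^ θ * max C 0,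
    mul_nonneg (Real.rpow_nonneg (by positivity) θ) (le_max_right _ _), fun t ht k => ?_⟩
  refine fracSymbol_mul_norm_le hθ (hψ.isSmooth_slice (mem_univ t)) (fun x => ?_) k
  rw [← FunctionSpaces.Torus.iterate_spaceTime_slice]
  exact (hC t ht x).trans (le_max_left _ _)

/-- **Uniform sup bound on compact time sets**: `‖((-Δ)^α ψ(t))(x)‖ ≤ M` for `t ∈ K`, all `x`. [folklore] -/
theorem exists_norm_fracLaplacian_le {θ : ℝ} (hθ : 0 ≤ θ)
    {ψ : ℝ → UnitAddTorus d → EuclideanSpace ℝ d} (hψ : FunctionSpaces.Torus.IsSmoothSpaceTimeOn univ ψ)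
    {K : Set ℝ} (hK : IsCompact K) :
    ∃ M : ℝ, 0 ≤ M ∧ ∀ t ∈ K, ∀ x, ‖fracLaplacian θ (ψ t) x‖ ≤ M := by
  obtain ⟨M, hM0, hM⟩ := exists_fracSymbol_mul_norm_le_spaceTime hθ hψ hK
  refine ⟨M * ∑' k : d → ℤ, ((1 + FunctionSpaces.Torus.freqNormSq k) ^ Fintype.card d)⁻¹,
    mul_nonneg hM0 (tsum_nonneg fun k => inv_nonneg.2
      (pow_nonneg (by linarith [FunctionSpaces.Torus.freqNormSq_nonneg k]) _)), fun t ht x => ?_⟩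
  have hs : FunctionSpaces.Torus.IsSmooth (ψ t) := hψ.isSmooth_slice (mem_univ t)
  refine (norm_fracLaplacian_le hθ hs x).trans ?_
  rw [← tsum_mul_left]
  exact Summable.tsum_le_tsum (hM t ht) (summable_fracSymbol_mul_norm hθ hs)
    (FunctionSpaces.Torus.summable_inv_one_add_freqNormSq_pow_card.mul_left _)

/-- **Joint continuity on compact time sets**: for `ψ` smooth on `ℝ × T^d` and `α ≥ 0`, the
space–time lift of `(t, x) ↦ ((-Δ)^α ψ(t))(x)` is continuous on `K × ℝ^d` for every compact `K`
(uniformly convergent series of jointly continuous modes; the coefficients `t ↦ 𝓕(ψ t)(k)` are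
differentiable in time, `Torus.hasDerivAt_mFourierCoeff_slice`). [folklore] -/
theorem continuousOn_stLift_fracLaplacian {θ : ℝ} (hθ : 0 ≤ θ)
    {ψ : ℝ → UnitAddTorus d → EuclideanSpace ℝ d} (hψ : FunctionSpaces.Torus.IsSmoothSpaceTimeOn univ ψ)
    {K : Set ℝ} (hK : IsCompact K) :
    ContinuousOn (FunctionSpaces.Torus.stLift fun t => fracLaplacian θ (ψ t)) (K ×ˢ univ) := by
  obtain ⟨M, hM0, hM⟩ := exists_fracSymbol_mul_norm_le_spaceTime hθ hψ hK
  set F : (d → ℤ) → ℝ × EuclideanSpace ℝ d → EuclideanSpace ℝ d := fun k p =>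
    FunctionSpaces.EuclideanSpace.realPart (fracSymbol θ k •
      (mFourier k (FunctionSpaces.Torus.proj p.2) • mFourierCoeff (FunctionSpaces.EuclideanSpace.complexify ∘ ψ p.1) k)) with hF
  have hfun : FunctionSpaces.Torus.stLift (fun t => fracLaplacian θ (ψ t)) = fun p => ∑' k, F k p := by
    funext p
    rw [FunctionSpaces.Torus.stLift_apply]
    exact fracLaplacian_eq_tsum_realPart hθ (hψ.isSmooth_slice (mem_univ p.1)) (FunctionSpaces.Torus.proj p.2)
  rw [hfun]
  refine continuousOn_tsum (fun k => ?_)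
    (FunctionSpaces.Torus.summable_inv_one_add_freqNormSq_pow_card.mul_left M) (fun k p hp => ?_)
  · refine Continuous.continuousOn ?_
    have hc : Continuous fun t : ℝ => mFourierCoeff (FunctionSpaces.EuclideanSpace.complexify ∘ ψ t) k :=
      continuous_iff_continuousAt.2 fun t => (FunctionSpaces.Torus.hasDerivAt_mFourierCoeff_slice hψ k t).continuousAt
    exact FunctionSpaces.EuclideanSpace.realPart.continuous.comp
      ((continuous_const (y := fracSymbol θ k)).smul
        (((mFourier k).continuous.comp (FunctionSpaces.Torus.continuous_proj.comp continuous_snd)).smul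
          (hc.comp continuous_fst)))
  · exact (norm_realPart_fracSymbol_smul_le θ k _ _).trans (hM p.1 (mem_prod.1 hp).1 k)

/-- **Joint continuity**: for `ψ` smooth on `ℝ × T^d` and `α ≥ 0`, `(t, x) ↦ ((-Δ)^α ψ(t))(x)`
has a continuous space–time lift on all of `ℝ × ℝ^d`. [folklore] -/
theorem continuous_stLift_fracLaplacian {θ : ℝ} (hθ : 0 ≤ θ)
    {ψ : ℝ → UnitAddTorus d → EuclideanSpace ℝ d} (hψ : FunctionSpaces.Torus.IsSmoothSpaceTimeOn univ ψ) :
    Continuous (FunctionSpaces.Torus.stLift fun t => fracLaplacian θ (ψ t)) := by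
  refine continuous_iff_continuousAt.2 fun p => ?_
  have h := continuousOn_stLift_fracLaplacian hθ hψ (isCompact_Icc (a := p.1 - 1) (b := p.1 + 1))
  refine h.continuousAt ?_
  rw [mem_nhds_prod_iff]
  exact ⟨Icc (p.1 - 1) (p.1 + 1), Icc_mem_nhds (by linarith) (by linarith), univ, univ_mem,
    subset_rfl⟩

/-- The slices `x ↦ ((-Δ)^α ψ(t))(x)` are continuous, and `t ↦ ∫ ⟪u t, (-Δ)^α ψ t⟫` is
continuous on `S` whenever `u` has a space–time lift continuous on `S × ℝ^d`. [folklore] -/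
theorem continuousOn_integral_inner_fracLaplacian {θ : ℝ} (hθ : 0 ≤ θ)
    {ψ : ℝ → UnitAddTorus d → EuclideanSpace ℝ d} (hψ : FunctionSpaces.Torus.IsSmoothSpaceTimeOn univ ψ)
    {S : Set ℝ} {u : ℝ → UnitAddTorus d → EuclideanSpace ℝ d}
    (hu : ContinuousOn (FunctionSpaces.Torus.stLift u) (S ×ˢ univ)) :
    ContinuousOn (fun t => ∫ x, ⟪u t x, fracLaplacian θ (ψ t) x⟫_ℝ) S := by
  have hΛ : ContinuousOn (FunctionSpaces.Torus.stLift fun t => fracLaplacian θ (ψ t)) (S ×ˢ univ) :=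
    (continuous_stLift_fracLaplacian hθ hψ).continuousOn
  have h : ContinuousOn (FunctionSpaces.Torus.stLift fun t x => ⟪u t x, fracLaplacian θ (ψ t) x⟫_ℝ) (S ×ˢ univ) :=
    continuous_inner.comp_continuousOn (hu.prodMk hΛ)
  -- continuity of the space integral in time (tube lemma over the compact torus)
  intro t ht
  rw [ContinuousWithinAt, Metric.tendsto_nhds]
  intro ε hε
  filter_upwards [FunctionSpaces.Torus.eventually_norm_sub_lt_of_continuousOn h ht (half_pos hε),
    self_mem_nhdsWithin] with s hs hsS
  have hslice : ∀ {r}, r ∈ S → Continuous fun x => ⟪u r x, fracLaplacian θ (ψ r) x⟫_ℝ := by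
    intro r hr
    have h1 : Continuous fun y : EuclideanSpace ℝ d =>
        FunctionSpaces.Torus.stLift (fun t x => ⟪u t x, fracLaplacian θ (ψ t) x⟫_ℝ) (r, y) :=
      h.comp_continuous (continuous_const.prodMk continuous_id) fun y => mk_mem_prod hr (mem_univ y)
    exact (FunctionSpaces.Torus.isOpenQuotientMap_proj (d := d)).isQuotientMap.continuous_iff.2 h1
  have hcs := hslice hsS
  have hct := hslice ht
  rw [dist_eq_norm, ← integral_sub hcs.integrable_unitAddTorus hct.integrable_unitAddTorus]
  calc ‖∫ x, (⟪u s x, fracLaplacian θ (ψ s) x⟫_ℝ - ⟪u t x, fracLaplacian θ (ψ t) x⟫_ℝ)‖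
      ≤ ∫ x, ‖⟪u s x, fracLaplacian θ (ψ s) x⟫_ℝ - ⟪u t x, fracLaplacian θ (ψ t) x⟫_ℝ‖ :=
        norm_integral_le_integral_norm _
    _ ≤ ∫ _ : UnitAddTorus d, ε / 2 := by
        refine integral_mono (hcs.sub hct).norm.integrable_unitAddTorus (integrable_const _)
          fun x => (hs x).le
    _ = ε / 2 := by simp
    _ < ε := half_lt_self hε

end SpaceTime

end Torus

end Literature.Analysis.FluidPDE
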